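import Summits.KontsevichZagierPeriods.Zeta5Search.SymmetricFamilyExactRates
import Summits.KontsevichZagierPeriods.Zeta5Search.Zudilin2002Signs
import HarnessLib

/-!
# ζ(5) search — row 7 (totally symmetric family): every cited input reduced to the two identifications (cell `pub-zeta5`, TYPER)

HONEST FRAMING: systematic search; no irrationality claim unless certified.

P1's `SymmetricFamilyMarginQ` states the cell's row-7 conclusions (non-vanishing of
`Q_nζ(5) - P_n`, the scaled-forms rate `log(d_n⁵|Q_nζ(5) - P_n|)/n → r ∈ (2.527, 2.528)`, the
margin `c - δ < -2.527`, no certificate with denominators `12 d_n⁵`) under the two CITED hypotheses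
`BrownZudilin2022.rates` and `Zudilin2002.theorem1_signs`. Both are now consequences of the two
limit identifications `pₙ/qₙ → ζ(5)`, `p̃ₙ/qₙ → ζ(3)` of Zudilin's recursion (typer:
`SymmetricFamilyRates.rates_of_tendsto`, `Zudilin2002Growth.theorem1_signs_of_tendsto`). This file
records the composites: `forms_ne_zero_of_tendsto`, `scaled_forms_rate_of_tendsto`,
`margin_lt_of_tendsto`, `no_certificate_of_tendsto` — row 7's epistemic status is
"PROVED modulo the identification of the two limits" (the hypergeometric content of Zudilin 2002,
Sect. 2 / BZ 2022, Sect. 2; P1's symmetric-ray programme). 0 sorry.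
-/

noncomputable section

open Filter Topology
open Literature.NumberTheory.Irrationality
open Literature.NumberTheory.Irrationality.BrownZudilin2022
open Literature.NumberTheory.Transcendental (zetaValue)

namespace Summit.KontsevichZagierPeriods.Zeta5Search.SymmetricRecursion

variable (h5 : Tendsto (fun n : ℕ => (Zudilin2002.p n : ℝ) / Zudilin2002.q n) atTop (𝓝 (zetaValue 5)))
  (h3 : Tendsto (fun n : ℕ => (Zudilin2002.ptilde n : ℝ) / Zudilin2002.q n) atTop (𝓝 (zetaValue 3)))
include h5 h3

/-- **`Q_nζ(5) - P_n ≠ 0`** (`n ≥ 1`) from the two identifications. -/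
theorem forms_ne_zero_of_tendsto {n : ℕ} (hn : 1 ≤ n) :
    (Q n : ℝ) * zetaValue 5 - (P n : ℝ) ≠ 0 :=
  forms_ne_zero (Zudilin2002Growth.theorem1_signs_of_tendsto h5 h3) hn

/-- **Scaled-forms rate** `log(d_n⁵|Q_nζ(5) - P_n|)/n → r ∈ (2.527, 2.528)` from the two identifications. -/
theorem scaled_forms_rate_of_tendsto :
    ∃ r : ℝ, (2527 / 1000 : ℝ) < r ∧ r < 2528 / 1000 ∧
      Tendsto (fun n : ℕ =>
        Real.log ((Nat.lcmUpto n : ℝ) ^ 5 * |(Q n : ℝ) * zetaValue 5 - (P n : ℝ)|) / n) atTop (𝓝 r) :=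
  scaled_forms_rate (SymmetricFamilyRates.rates_of_tendsto h5 h3)
    (Zudilin2002Growth.theorem1_signs_of_tendsto h5 h3)

/-- **Margin** `c - δ < -2.527` for any admissible decay/denominator exponents, from the two identifications. -/
theorem margin_lt_of_tendsto {c δ : ℝ}
    (hc : ∀ᶠ n : ℕ in atTop, |(Q n : ℝ) * zetaValue 5 - (P n : ℝ)| ≤ Real.exp (-(c * n)))
    (hδ : ∀ᶠ n : ℕ in atTop, ((Nat.lcmUpto n : ℝ)) ^ 5 ≤ Real.exp (δ * n)) :
    c - δ < -(2527 / 1000) :=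
  margin_lt (SymmetricFamilyRates.rates_of_tendsto h5 h3)
    (Zudilin2002Growth.theorem1_signs_of_tendsto h5 h3) hc hδ

/-- **No certificate** with denominators `12 d_n⁵` and bounded savings, from the two identifications. -/
theorem no_certificate_of_tendsto (K : ℕ) :
    ¬ ∃ cert : LinearFormCertificate (zetaValue 5),
        (∀ n, cert.form n = (Q n : ℝ) * zetaValue 5 - (P n : ℝ))
        ∧ (∀ n, cert.denom n = 12 * Nat.lcmUpto n ^ 5) ∧ (∀ n, cert.saving n ≤ K) :=
  no_certificate (SymmetricFamilyRates.rates_of_tendsto h5 h3)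
    (Zudilin2002Growth.theorem1_signs_of_tendsto h5 h3) K

end Summit.KontsevichZagierPeriods.Zeta5Search.SymmetricRecursion
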